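import Summits.BirchSwinnertonDyer.Rank1Residual.X11b.KummerTwistIntersection
import Mathlib.NumberTheory.Padics.Complex
import Mathlib.RingTheory.Polynomial.Cyclotomic.Basic
import Mathlib.RingTheory.Polynomial.Cyclotomic.Eval
import Mathlib.RingTheory.RootsOfUnity.AlgebraicallyClosed
import Mathlib.Analysis.Normed.Group.Ultra
import HarnessLib

/-!
# X11b — the twist-intersection lemma over a DISCRETELY VALUED subfield of `ℂ_p`, `p` odd:
# `‖ζ_p − 1‖^{p−1} = p⁻¹`, so such a subfield has no primitive `p`-th root of unity

HONEST FRAMING (cell `b2b-bsdres`, run/shared/lean/b2b/bsd-rank1-residual/, verbatim in every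
file): the goal of the cell is to DELETE the COMBINATION-SHAPED residual classes of the
Birch–Swinnerton-Dyer formula for ALL analytic-rank `≤ 1` elliptic curves over `ℚ` — "full BSD
formula for every rank `≤ 1` curve in class `C`" assembled STRICTLY from published theorems — so
that the rank-`≤ 1` remainder becomes exactly the CONSTRUCTION-SHAPED classes, which are TYPED
(missing-input `Prop`s), NOT attempted. This is not "finishing BSD". Sub-cell
`b2b-bsdres-multr1-p1` (X11b, route R1, gen 24); THEOREMS ONLY (no definition, no named fact, no
`sorry`); elementary `p`-adic analysis in `ℂ_p`, every prime `p` (oddness where stated); nothing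
about any curve. Companion of `KummerTwistIntersection.lean` (the pure field-theory lemma): it
discharges that lemma's hypothesis "no primitive `p`-th root of unity in `L`" for every DISCRETELY
VALUED subfield `L ⊆ ℂ_p` when `p` is odd, and so ISOLATES the one fact about the tree's
`R₀ = unrIntegers p` on which a kernel `R₀`-descent (DESCENT-NOTE STEP B) would rest.

## What this file proves

* §1 `R1.norm_sub_one_pow_of_isPrimitiveRoot`: for a primitive `p`-th root of unity `ζ ∈ ℂ_p`,
  `‖ζ − 1‖^{p−1} = p⁻¹` (from `p = Φ_p(1) = ∏_{μ primitive}(1 − μ)` and `‖1 − ζ^k‖ = ‖1 − ζ‖` for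
  `p ∤ k`, ultrametric); `R1.norm_sub_one_ne_zpow`: hence `‖ζ − 1‖ ∉ p^ℤ` for `p ≠ 2`.
* §2 `R1.pow_eq_one_imp_eq_one_of_norm_zpow`: a subfield `L ⊆ ℂ_p` all of whose non-zero elements
  have norm in `p^ℤ` (`p ≠ 2`) satisfies `z^p = 1 ⟹ z = 1` — the hypothesis `hL` of
  `R1.mem_subfield_of_forall_mem_closure`.
* §3 `R1.mem_subfield_padic_of_forall_mem_closure`: for such `L`, `u ∈ L ∖ {0}`, `x^{p^a} = u`:
  `y ∈ (subfield generated by L and ηx)` for every `p^a`-th root of unity `η` ⟹ `y ∈ L` (the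
  primitive `p^a`-th root of unity exists in the algebraically closed `ℂ_p`).

## What this file does NOT do (the isolated input)

DISCRETENESS of `Frac R₀` for the tree's `R₀ = unrIntegers p` (the closure in `ℂ_p` of the subring
generated by the roots of unity of order prime to `p`): "`x ∈ Frac R₀`, `x ≠ 0 ⟹ ‖x‖ ∈ p^ℤ`", i.e.
that `ℚ_p(μ_m)`, `p ∤ m`, is UNRAMIFIED (plus density and the ultrametric stability of norms under
limits). It is not in the tree and not attempted; with it, §3 applies verbatim to `L = Frac R₀` and,
together with gen 23's descent of coefficients from values (`BDPFrameUniquenessInt.lean`) and the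
valuation-ring property of `R₀`, gives the kernel form of "`⋂_ε 𝒲_{ψε}⟦T⟧ = Λ_{R₀}`". None of
this is load-bearing for route R1 (open input `R₀`-free since gen 23); at `p = 3` it is team
x11b3's call (lead R8-15; nothing of `Three.` is touched or claimed here).

References: [Castella2018] F. Castella, Camb. J. Math. 6 (2018), p. 9 ll. 42–47 (arXiv:1704.06608);
[Cassels1986] J. W. S. Cassels, *Local Fields*, Ch. 6 (cyclotomic extensions of `ℚ_p`: `ℚ_p(ζ_p)`
totally ramified with `|1 − ζ_p|^{p−1} = |p|`; `ℚ_p(ζ_m)`, `p ∤ m`, unramified).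
-/

noncomputable section

open scoped Classical

open Polynomial

namespace Summit.BirchSwinnertonDyer.Rank1Residual.X11b

variable {p : ℕ} [hp : Fact p.Prime]

/-! ### §1 `‖ζ − 1‖^{p−1} = p⁻¹` for a primitive `p`-th root of unity `ζ ∈ ℂ_p` -/

/-- A root of unity in `ℂ_p` has norm `1`. [folklore] -/
theorem R1.norm_eq_one_of_pow_eq_one {z : ℂ_[p]} {n : ℕ} (hn : 0 < n) (hz : z ^ n = 1) :
    ‖z‖ = 1 := by
  have h : ‖z‖ ^ n = 1 := by rw [← norm_pow, hz, norm_one]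
  exact (pow_eq_one_iff_of_nonneg (norm_nonneg z) hn.ne').mp h

/-- `‖1 − ζ^k‖ ≤ ‖1 − ζ‖` for `‖ζ‖ ≤ 1` in `ℂ_p` (ultrametric inequality applied to
`1 − ζ^k = (1 − ζ)(1 + ζ + ⋯ + ζ^{k−1})`). [folklore] -/
theorem R1.norm_one_sub_pow_le {ζ : ℂ_[p]} (hζ : ‖ζ‖ ≤ 1) (k : ℕ) : ‖1 - ζ ^ k‖ ≤ ‖1 - ζ‖ := by
  have hgeom : 1 - ζ ^ k = (1 - ζ) * ∑ i ∈ Finset.range k, ζ ^ i := by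
    exact (mul_neg_geom_sum ζ k).symm
  have hsum : ‖∑ i ∈ Finset.range k, ζ ^ i‖ ≤ 1 :=
    IsUltrametricDist.norm_sum_le_of_forall_le_of_nonneg zero_le_one fun i _ ↦ by
      rw [norm_pow]; exact pow_le_one₀ (norm_nonneg ζ) hζ
  rw [hgeom, norm_mul]
  exact mul_le_of_le_one_right (norm_nonneg _) hsum

/-- For a primitive `n`-th root of unity `ζ ∈ ℂ_p` and `k` prime to `n`: `‖1 − ζ^k‖ = ‖1 − ζ‖` (each
of `ζ`, `ζ^k` is a power of the other). [folklore] -/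
theorem R1.norm_one_sub_pow_eq {ζ : ℂ_[p]} {n : ℕ} (hn : 0 < n) (hζ : IsPrimitiveRoot ζ n) {k : ℕ}
    (hk : k.Coprime n) : ‖1 - ζ ^ k‖ = ‖1 - ζ‖ := by
  haveI : NeZero n := ⟨hn.ne'⟩
  have hζ1 : ‖ζ‖ ≤ 1 := (R1.norm_eq_one_of_pow_eq_one hn hζ.pow_eq_one).le
  refine le_antisymm (R1.norm_one_sub_pow_le hζ1 k) ?_
  obtain ⟨i, -, hi⟩ := (hζ.pow_of_coprime k hk).eq_pow_of_pow_eq_one hζ.pow_eq_one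
  have hζk1 : ‖ζ ^ k‖ ≤ 1 := by rw [norm_pow]; exact pow_le_one₀ (norm_nonneg ζ) hζ1
  calc ‖1 - ζ‖ = ‖1 - (ζ ^ k) ^ i‖ := by rw [hi]
    _ ≤ ‖1 - ζ ^ k‖ := R1.norm_one_sub_pow_le hζk1 i

/-- **`‖ζ − 1‖^{p−1} = p⁻¹`** for a primitive `p`-th root of unity `ζ ∈ ℂ_p`: from
`p = Φ_p(1) = ∏_{μ primitive} (1 − μ)` and `‖1 − μ‖ = ‖1 − ζ‖` for each of the `p − 1` primitive
roots `μ = ζ^k`. (So `ℚ_p(ζ_p)` is totally ramified: `‖ζ − 1‖ = p^{−1/(p−1)}`.) [folklore] -/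
theorem R1.norm_sub_one_pow_of_isPrimitiveRoot {ζ : ℂ_[p]} (hζ : IsPrimitiveRoot ζ p) :
    ‖ζ - 1‖ ^ (p - 1) = (p : ℝ)⁻¹ := by
  have hp' : p.Prime := hp.out
  haveI : NeZero p := ⟨hp'.ne_zero⟩
  have hprod : (p : ℂ_[p]) = ∏ μ ∈ primitiveRoots p ℂ_[p], (1 - μ) := by
    have h := congrArg (Polynomial.eval (1 : ℂ_[p])) (cyclotomic_eq_prod_X_sub_primitiveRoots hζ)
    rw [eval_one_cyclotomic_prime, eval_prod] at h
    simpa only [eval_sub, eval_X, eval_C] using h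
  have hnorm : ‖(p : ℂ_[p])‖ = (p : ℝ)⁻¹ := by
    rw [← map_natCast (algebraMap ℚ_[p] ℂ_[p]) p]
    exact (PadicComplex.norm_extends' (p := p) (p : ℚ_[p])).trans (Padic.norm_p)
  have hconst : ∀ μ ∈ primitiveRoots p ℂ_[p], ‖1 - μ‖ = ‖ζ - 1‖ := by
    intro μ hμ
    rw [mem_primitiveRoots hp'.pos] at hμ
    obtain ⟨k, -, hk, rfl⟩ := (hζ.isPrimitiveRoot_iff).mp hμ
    rw [R1.norm_one_sub_pow_eq hp'.pos hζ hk, norm_sub_rev]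
  rw [← hnorm, hprod, norm_prod, Finset.prod_congr rfl hconst, Finset.prod_const,
    hζ.card_primitiveRoots, Nat.totient_prime hp']

/-- For `p` odd, `‖ζ − 1‖` is NOT an integral power of `p` (`(p−1)·n = −1` is impossible).
[folklore] -/
theorem R1.norm_sub_one_ne_zpow (hp2 : p ≠ 2) {ζ : ℂ_[p]} (hζ : IsPrimitiveRoot ζ p) (n : ℤ) :
    ‖ζ - 1‖ ≠ (p : ℝ) ^ n := by
  have hp' : p.Prime := hp.out
  intro h
  have hpow := R1.norm_sub_one_pow_of_isPrimitiveRoot hζ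
  rw [h, ← zpow_natCast, ← zpow_mul, ← zpow_neg_one] at hpow
  have hinj : n * ((p - 1 : ℕ) : ℤ) = -1 :=
    zpow_right_injective₀ (by exact_mod_cast hp'.pos) (by exact_mod_cast hp'.one_lt.ne') hpow
  have hdvd : ((p - 1 : ℕ) : ℤ) ∣ 1 := ⟨-n, by linear_combination hinj⟩
  have h1 : ((p - 1 : ℕ) : ℤ) = 1 := Int.eq_one_of_dvd_one (by positivity) hdvd
  have h1' : p - 1 = 1 := by exact_mod_cast h1
  have := hp'.two_le
  omega

/-! ### §2 A discretely valued subfield of `ℂ_p`, `p` odd, has no primitive `p`-th root of unity -/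

/-- **No `ζ_p` in a discretely valued subfield (`p` odd).** If every non-zero element of a subfield
`L ⊆ ℂ_p` has norm an INTEGRAL power of `p` — e.g. `L = Frac R₀`, `R₀ = unrIntegers p` the closure
of `ℤ[μ_{p'}]` (= "`ℚ_p(μ_m)`, `p ∤ m`, is unramified"; NOT proved in the tree) — then
`z^p = 1 ⟹ z = 1` in `L`: otherwise `z` is a primitive `p`-th root of unity and `z − 1 ∈ L` has
norm `p^{−1/(p−1)}`. This is the hypothesis `hL` of `R1.mem_subfield_of_forall_mem_closure`.
[folklore] -/
theorem R1.pow_eq_one_imp_eq_one_of_norm_zpow (hp2 : p ≠ 2) (L : Subfield ℂ_[p])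
    (hL : ∀ w ∈ L, w ≠ 0 → ∃ n : ℤ, ‖w‖ = (p : ℝ) ^ n) :
    ∀ z ∈ L, z ^ p = 1 → z = 1 := by
  intro z hz hzp
  by_contra hz1
  have hζ : IsPrimitiveRoot z p := by
    have h := IsPrimitiveRoot.orderOf z
    rwa [orderOf_eq_prime hzp hz1] at h
  obtain ⟨n, hn⟩ := hL (z - 1) (L.sub_mem hz L.one_mem) (sub_ne_zero.mpr hz1)
  exact R1.norm_sub_one_ne_zpow hp2 hζ n hn

/-! ### §3 The twist-intersection lemma over a discretely valued subfield of `ℂ_p` -/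

/-- **Twist-intersection over a discretely valued `L ⊆ ℂ_p`, `p` odd.** If every non-zero element
of the subfield `L` has norm in `p^ℤ`, `u ∈ L ∖ {0}`, `x ∈ ℂ_p` with `x^{p^a} = u`, and `y ∈ ℂ_p`
lies in the subfield generated by `L` and `ηx` for EVERY `p^a`-th root of unity `η ∈ ℂ_p`, then
`y ∈ L`. (`ℂ_p` is algebraically closed of characteristic `0`, so the primitive `p^a`-th root of
unity needed by `R1.mem_subfield_of_forall_mem_closure` exists; `ζ_p ∉ L` is §2.) With
`L = Frac R₀` this is STEP B of the `R₀`-descent (DESCENT-NOTE §2′) modulo the ONE fact about the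
tree's `R₀` it isolates:
DISCRETENESS of `Frac (unrIntegers p)` — not proved here, not in the tree. [folklore] -/
theorem R1.mem_subfield_padic_of_forall_mem_closure (hp2 : p ≠ 2) (L : Subfield ℂ_[p])
    (hL : ∀ w ∈ L, w ≠ 0 → ∃ n : ℤ, ‖w‖ = (p : ℝ) ^ n) {a : ℕ} {u : ℂ_[p]} (huL : u ∈ L)
    (hu : u ≠ 0) {x : ℂ_[p]} (hx : x ^ p ^ a = u) {y : ℂ_[p]}
    (hy : ∀ η : ℂ_[p], η ^ p ^ a = 1 → y ∈ Subfield.closure ((L : Set ℂ_[p]) ∪ {η * x})) :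
    y ∈ L := by
  haveI : NeZero ((p : ℕ) : ℂ_[p]) := ⟨by exact_mod_cast hp.out.ne_zero⟩
  obtain ⟨ζ, hζ⟩ := HasEnoughRootsOfUnity.prim (M := ℂ_[p]) (n := p ^ a)
  exact R1.mem_subfield_of_forall_mem_closure L (R1.pow_eq_one_imp_eq_one_of_norm_zpow hp2 L hL)
    hζ huL hu hx hy

end Summit.BirchSwinnertonDyer.Rank1Residual.X11b

end
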